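import Literature.Computability.AlgebraicComplexity.StandardFamilies
import HarnessLib

/-!
# Named fact: the iterated matrix multiplication family is in `VP`

Trunk T-CPLX-ALG, sibling of `StandardFamilies.lean` (`CplxAlg.immPoly`, `CplxAlg.immPoly_isHomogeneous`)
and `IMMDepthFour.lean` (`CplxAlg.kumar_saraf_imm_depth4`). Used by the barrier catalogue entry
`Literature/Barriers/ValiantsHypothesis/DepthReductionChasm.lean` (Kumar–Saraf 2017, Cor. 1.3:
depth reduction is tight, witnessed by `IMM ∈ VP`) and available to the `Depth4`/GCT users of
`immPoly` without importing a barrier file.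

**Print.** Kumar–Saraf, SIAM J. Comput. 46 (2017) (arXiv:1404.1950), §3 "Iterated Matrix
Multiplication": "Let `M₁, …, M_b` be `b` generic square matrices, each of dimension `a × a`. Then,
we define the polynomial `IMM_{a,b}` as the `(1,1)` entry of the matrix `∏_j M_j`. It is easy to
see that this polynomial can be computed by a polynomial sized circuit, and so is in `VP`."

**Rendering.** The tree's `CplxAlg.immPoly a b k` is the TRACE `tr(X⁽¹⁾ ⋯ X⁽ᵇ⁾)` of the product
of `b` generic `a × a` matrices (`StandardFamilies.lean`; Limaye–Srinivasan–Tavenas use the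
`(1,1)` entry — both are entries/sums of entries of the iterated product, computed by the same
`O(b · a³)`-size circuit that multiplies the matrices out one at a time). For every exponent `c`
the family `n ↦ IMM_{n^c, n}` has `n · n^{2c}` variables, degree `n`, and circuits of size
`O(n^{3c+1})`, so it is a `VP` family over EVERY field (`CplxAlg.IsVPFamily`: p-bounded variables,
degree and fan-in-two `complexity`; print works over an arbitrary field `𝔽`, as does the tree's
`CplxAlg.kumar_saraf_imm_depth4`). Stated as a named fact (D-0014): the tree's `complexity` is defined
through explicit `ArithCircuit` gate lists, and the matrix-product circuit has not been built in
that model yet (cf. the `~900`-line circuit plumbing of `DepthReductionProofs.lean`). Nothing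
asserted.

## References

* M. Kumar, S. Saraf, *On the power of homogeneous depth 4 arithmetic circuits*, SIAM J. Comput.
  46 (2017) 336–387, §3 (Preliminaries, "Iterated Matrix Multiplication") and Thm. 1.2.
-/

noncomputable section

namespace Literature.Computability.AlgebraicComplexity

/-- NAMED FACT (**`IMM ∈ VP`**; Kumar–Saraf 2017, §3: "`IMM_{a,b}` ... can be computed by a
polynomial sized circuit, and so is in `VP`", over the paper's arbitrary field): for every field
`k` and every exponent `c`, the iterated matrix multiplication family
`n ↦ immPoly (n ^ c) n k = tr(X⁽¹⁾ ⋯ X⁽ⁿ⁾)` (`n` generic `n^c × n^c` matrices; `n^{2c+1}` variables,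
degree `n`, circuit size `O(n^{3c+1})`) is a `VP` family over `k`. Users take
`(h : isVPFamily_immPoly)`. [cite: KumarSaraf2017, §3] -/
def isVPFamily_immPoly : Prop :=
  ∀ (k : Type) [Field k] (c : ℕ), IsVPFamily (fun n => immPoly (n ^ c) n k)

/-- The instance at a fixed field and exponent. [cite: KumarSaraf2017, §3] -/
theorem isVPFamily_immPoly.at (h : isVPFamily_immPoly) (k : Type) [Field k] (c : ℕ) :
    IsVPFamily (fun n => immPoly (n ^ c) n k) :=
  h k c

end Literature.Computability.AlgebraicComplexity
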